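import Summits.NavierStokesRegularity.NavierStokesRegularity.Theses.RellichScar
import Summits.NavierStokesRegularity.NavierStokesRegularity.Theorems.ScarRigidity.Negative.LogicAndLoadBearing
import Literature.Analysis.FluidPDE.TypeIAncientMild
import Literature.Analysis.FluidPDE.ParasiticSlabFlow
import Literature.Analysis.FluidPDE.RusinSverakCompactnessProofs
import HarnessLib

/-!
# `ScarRigidity` — line `finite-energy-log-convexity`, stub `stub_twinNorms`
# (crux stmt-NavierStokesRegularity-11717, route RellichScar)

**S2 — finite energy of a scar-sharing pair, with pure-scaling rates ("finite energy is what the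
scar buys").** Let `V₁, V₂ : ℝ → ℝ³ → ℝ³` obey the apex bound `‖Vᵢ(t, x)‖ ≤ C/(‖x‖ + √(−t))`, the
gradient bounds `‖∇Vᵢ(t, x)‖ ≤ Lᵢ/(‖x‖ + √(−t))²` and the far-field bound
`‖V₁ − V₂‖ ≤ K(−t)/‖x‖³` (`x ≠ 0`). Write `a = √(−t)`, `ρ = ‖x‖ + a`, `w = V₁ − V₂`. Then

* (d) `‖w(t, x)‖ ≤ K'(−t)/ρ³` for ALL `x`: in the core `‖x‖ ≤ a` one has `‖w‖ ≤ 2C/ρ` and `ρ ≤ 2a`,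
  so `2C/ρ ≤ 8C a²/ρ³`; off the core `K a²/‖x‖³ ≤ 8K a²/ρ³` since `ρ ≤ 2‖x‖`;
* (a) `‖w(t)‖_{L²} ≤ K'|t|^{1/4}`, (b) `‖w(t)‖_{L^{6/5}} ≤ K'|t|^{3/4}`, (c) `‖∇w(t)‖_{L²} ≤ K'|t|^{−1/4}`.

(a)–(c) are instances of one scaling lemma (`exists_eLpNorm_le_of_norm_le_radial`): if
`‖f(x)‖ ≤ M/(‖x‖ + a)ⁿ` on `ℝ³` and `n·p > 3`, then `‖f‖_{Lᵖ} ≤ A·M·a^{3/p − n}` with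
`A = (∫ (1 + ‖y‖)^{−np} dy)^{1/p} < ∞` (Mathlib `finite_integral_one_add_norm`), by the substitution
`x = a·y` (Mathlib `Measure.map_addHaar_smul`, through the tree's dilation formula
`HomSobolevSymmetry.lintegral_comp_smul` of `RusinSverakCompactnessProofs`, already in the import
closure of the route file). No measurability is needed: the `Lᵖ` seminorm is compared with the
explicit radial majorant through `lintegral_mono`.
-/

noncomputable section

open Set Filter Function MeasureTheory Metric TopologicalSpace
open scoped Topology ENNReal NNReal InnerProductSpace RealInnerProductSpace
open Literature.Analysis.FluidPDE
open Summit.NavierStokesRegularity.NavierStokesRegularity.Theses.RellichScar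
open Summit.NavierStokesRegularity.NavierStokesRegularity.Theorems.ScarRigidity.Negative

set_option linter.dupNamespace false -- D-0017: `Summit.<S>.<S>.…` repeats the summit name by design

namespace Summit.NavierStokesRegularity.NavierStokesRegularity.Theorems.RellichScarScarRigidity

/-- Physical space. -/
local notation "ℝ³" => EuclideanSpace ℝ (Fin 3)

/-- The open backward slab `(-∞,0) × ℝ³` (time first), as in the route file. -/
local notation "𝕊" => Literature.Analysis.FluidPDE.slab (EuclideanSpace ℝ (Fin 3)) (Set.Iio (0 : ℝ)) isOpen_Iio

/-! ## The radial profiles `(‖x‖ + a)^{-r}` under the dilation `x = a y` -/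

/-- Scaling of the radial profile: `∫ (‖x‖ + a)^{-r} dx = a^{-r} · a³ · ∫ (1 + ‖y‖)^{-r} dy` on `ℝ³`
for `a > 0` (substitute `x = a y`; the dilation formula `∫⁻ f(c x) dx = c⁻³ ∫⁻ f` is the tree's
`HomSobolevSymmetry.lintegral_comp_smul`, Mathlib `Measure.map_addHaar_smul`). [folklore] -/
theorem lintegral_radial_rpow_neg {a r : ℝ} (ha : 0 < a) :
    ∫⁻ x : ℝ³, ENNReal.ofReal ((‖x‖ + a) ^ (-r)) =
      ENNReal.ofReal (a ^ (-r)) *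
        (ENNReal.ofReal (a ^ 3) * ∫⁻ y : ℝ³, ENNReal.ofReal ((1 + ‖y‖) ^ (-r))) := by
  have hscale : ∫⁻ x : ℝ³, ENNReal.ofReal ((1 + ‖a⁻¹ • x‖) ^ (-r)) =
      ENNReal.ofReal (a ^ 3) * ∫⁻ y : ℝ³, ENNReal.ofReal ((1 + ‖y‖) ^ (-r)) := by
    have h := HomSobolevSymmetry.lintegral_comp_smul
      (fun y : ℝ³ => ENNReal.ofReal ((1 + ‖y‖) ^ (-r))) (inv_pos.2 ha)
    rwa [inv_pow, inv_inv] at h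
  rw [← hscale, ← lintegral_const_mul' _ _ ENNReal.ofReal_ne_top]
  refine lintegral_congr fun x => ?_
  rw [← ENNReal.ofReal_mul (Real.rpow_nonneg ha.le _), norm_smul,
    Real.norm_of_nonneg (inv_nonneg.2 ha.le), ← Real.mul_rpow ha.le (by positivity)]
  congr 2
  field_simp
  ring

/-- **Scaling lemma for radial majorants.** If `‖f(x)‖ ≤ M/(‖x‖ + a)ⁿ` on `ℝ³` (`a > 0`, `M ≥ 0`)
and `n·q > 3` where `q = p.toReal > 0`, then `‖f‖_{Lᵖ(ℝ³)} ≤ A · M · a^γ`, `γ = 3/q − n`, with the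
constant `A = (∫ (1 + ‖y‖)^{−nq} dy)^{1/q}` depending only on `n, q` (finite because `nq > 3`,
Mathlib `finite_integral_one_add_norm`); substitution `x = a y`. No measurability of `f` is
needed. [folklore] -/
theorem exists_eLpNorm_le_of_norm_le_radial {F : Type*} [NormedAddCommGroup F] {p : ℝ≥0∞} {q : ℝ}
    (hq : 0 < q) (hpq : p.toReal = q) {n : ℕ} (hn : 3 < n * q) {γ : ℝ} (hγ : γ = 3 / q - n) :
    ∃ A : ℝ, 0 ≤ A ∧ ∀ (a M : ℝ), 0 < a → 0 ≤ M → ∀ f : ℝ³ → F,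
      (∀ x, ‖f x‖ ≤ M / (‖x‖ + a) ^ n) → eLpNorm f p volume ≤ ENNReal.ofReal (A * M * a ^ γ) := by
  have hJ : (∫⁻ y : ℝ³, ENNReal.ofReal ((1 + ‖y‖) ^ (-(n * q)))) < ∞ :=
    finite_integral_one_add_norm (μ := volume)
      (by rw [finrank_euclideanSpace_fin]; exact_mod_cast hn)
  have hI : 0 ≤ (∫⁻ y : ℝ³, ENNReal.ofReal ((1 + ‖y‖) ^ (-(n * q)))).toReal :=
    ENNReal.toReal_nonneg
  refine ⟨(∫⁻ y : ℝ³, ENNReal.ofReal ((1 + ‖y‖) ^ (-(n * q)))).toReal ^ q⁻¹,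
    Real.rpow_nonneg hI _, ?_⟩
  intro a M ha hM f hf
  have hp0 : p ≠ 0 := by
    rintro rfl
    rw [ENNReal.toReal_zero] at hpq
    exact hq.ne hpq
  have hptop : p ≠ ∞ := by
    rintro rfl
    rw [ENNReal.toReal_top] at hpq
    exact hq.ne hpq
  have hA : 0 ≤ (∫⁻ y : ℝ³, ENNReal.ofReal ((1 + ‖y‖) ^ (-(n * q)))).toReal ^ q⁻¹ :=
    Real.rpow_nonneg hI _
  have hB : 0 ≤ (∫⁻ y : ℝ³, ENNReal.ofReal ((1 + ‖y‖) ^ (-(n * q)))).toReal ^ q⁻¹ * M * a ^ γ :=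
    mul_nonneg (mul_nonneg hA hM) (Real.rpow_nonneg ha.le _)
  have hMq : 0 ≤ M ^ q := Real.rpow_nonneg hM _
  have har : 0 ≤ a ^ (-(n * q)) := Real.rpow_nonneg ha.le _
  have ha3 : 0 ≤ a ^ 3 := pow_nonneg ha.le 3
  -- the right-hand side, raised to the power `q`
  have hRHS : ((∫⁻ y : ℝ³, ENNReal.ofReal ((1 + ‖y‖) ^ (-(n * q)))).toReal ^ q⁻¹ * M * a ^ γ) ^ q
      = M ^ q * (a ^ (-(n * q)) *
          (a ^ 3 * (∫⁻ y : ℝ³, ENNReal.ofReal ((1 + ‖y‖) ^ (-(n * q)))).toReal)) := by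
    rw [Real.mul_rpow (mul_nonneg hA hM) (Real.rpow_nonneg ha.le _), Real.mul_rpow hA hM,
      ← Real.rpow_mul hI, inv_mul_cancel₀ hq.ne', Real.rpow_one, ← Real.rpow_mul ha.le, hγ]
    have e : (3 / q - (n : ℝ)) * q = -(n * q) + 3 := by
      field_simp
      ring
    rw [e, Real.rpow_add ha, Real.rpow_ofNat]
    ring
  rw [eLpNorm_eq_lintegral_rpow_enorm_toReal hp0 hptop, hpq, one_div, ENNReal.rpow_inv_le_iff hq,
    ENNReal.ofReal_rpow_of_nonneg hB hq.le, hRHS, ENNReal.ofReal_mul hMq, ENNReal.ofReal_mul har,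
    ENNReal.ofReal_mul ha3, ENNReal.ofReal_toReal hJ.ne, ← lintegral_radial_rpow_neg ha,
    ← lintegral_const_mul' _ _ ENNReal.ofReal_ne_top]
  refine lintegral_mono fun x => ?_
  have hρ : 0 < ‖x‖ + a := by positivity
  have hpt : ‖f x‖ ^ q ≤ M ^ q * (‖x‖ + a) ^ (-(n * q)) := by
    calc ‖f x‖ ^ q ≤ (M / (‖x‖ + a) ^ n) ^ q := Real.rpow_le_rpow (norm_nonneg _) (hf x) hq.le
      _ = M ^ q * (‖x‖ + a) ^ (-(n * q)) := by
          rw [Real.div_rpow hM (pow_nonneg hρ.le _), Real.rpow_neg hρ.le, ← Real.rpow_natCast,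
            ← Real.rpow_mul hρ.le, div_eq_mul_inv]
  rw [← ENNReal.ofReal_mul hMq, ← ofReal_norm, ENNReal.ofReal_rpow_of_nonneg (norm_nonneg _) hq.le]
  exact ENNReal.ofReal_le_ofReal hpt

/-! ## The single majorant -/

/-- **(d) The single majorant.** From the apex bound `‖Vᵢ‖ ≤ C/(‖x‖ + √(−t))` on both fields and the
far-field bound `‖V₁ − V₂‖ ≤ K(−t)/‖x‖³` (`x ≠ 0`): for every `t < 0` and EVERY `x`,
`‖V₁(t,x) − V₂(t,x)‖ ≤ 8(C + max(K,0))·(−t)/(‖x‖ + √(−t))³` (core `‖x‖ ≤ √(−t)`: `2C/ρ ≤ 8C(−t)/ρ³` as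
`ρ ≤ 2√(−t)`; off the core: `ρ ≤ 2‖x‖`). [folklore] -/
theorem norm_sub_le_majorant {V₁ V₂ : ℝ → ℝ³ → ℝ³} {C K : ℝ} (hd₁ : HasTypeIDecay C V₁)
    (hd₂ : HasTypeIDecay C V₂)
    (hfar : ∀ t < 0, ∀ x : ℝ³, x ≠ 0 → ‖V₁ t x - V₂ t x‖ ≤ K * (-t) / ‖x‖ ^ 3) {t : ℝ} (ht : t < 0)
    (x : ℝ³) :
    ‖V₁ t x - V₂ t x‖ ≤ 8 * (C + max K 0) * (-t) / (‖x‖ + Real.sqrt (-t)) ^ 3 := by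
  have hC : 0 ≤ C := nonneg_of_hasTypeIDecay hd₁
  have h₁ := hd₁ t ht x
  have h₂ := hd₂ t ht x
  have hfx := hfar t ht x
  have hs : 0 < -t := neg_pos.2 ht
  set s : ℝ := -t with hs_def
  set a : ℝ := Real.sqrt s with ha_def
  have ha : 0 < a := Real.sqrt_pos.2 hs
  have ha2 : a ^ 2 = s := Real.sq_sqrt hs.le
  have hρ : 0 < ‖x‖ + a := by positivity
  rcases le_or_gt ‖x‖ a with hxa | hxa
  · -- the parabolic core `‖x‖ ≤ √(-t)`
    have hw : ‖V₁ t x - V₂ t x‖ ≤ 2 * C / (‖x‖ + a) :=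
      calc ‖V₁ t x - V₂ t x‖ ≤ ‖V₁ t x‖ + ‖V₂ t x‖ := norm_sub_le _ _
        _ ≤ C / (‖x‖ + a) + C / (‖x‖ + a) := add_le_add h₁ h₂
        _ = 2 * C / (‖x‖ + a) := by ring
    refine hw.trans ?_
    rw [div_le_div_iff₀ hρ (pow_pos hρ 3), ← ha2]
    have hρ2a : ‖x‖ + a ≤ 2 * a := by linarith
    calc 2 * C * (‖x‖ + a) ^ 3 = 2 * C * (‖x‖ + a) ^ 2 * (‖x‖ + a) := by ring
      _ ≤ 2 * C * (2 * a) ^ 2 * (‖x‖ + a) := by gcongr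
      _ = 8 * C * a ^ 2 * (‖x‖ + a) := by ring
      _ ≤ 8 * (C + max K 0) * a ^ 2 * (‖x‖ + a) := by
          gcongr
          exact le_add_of_nonneg_right (le_max_right _ _)
  · -- off the core `‖x‖ > √(-t)`, in particular `x ≠ 0`
    have hxpos : 0 < ‖x‖ := ha.trans hxa
    have hx0 : x ≠ 0 := norm_pos_iff.1 hxpos
    have hw : ‖V₁ t x - V₂ t x‖ ≤ max K 0 * s / ‖x‖ ^ 3 :=
      (hfx hx0).trans (div_le_div_of_nonneg_right
        (mul_le_mul_of_nonneg_right (le_max_left _ _) hs.le) (pow_nonneg hxpos.le 3))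
    refine hw.trans ?_
    rw [div_le_div_iff₀ (pow_pos hxpos 3) (pow_pos hρ 3)]
    have hρ2x : ‖x‖ + a ≤ 2 * ‖x‖ := by linarith
    calc max K 0 * s * (‖x‖ + a) ^ 3 ≤ max K 0 * s * (2 * ‖x‖) ^ 3 := by gcongr
      _ = 8 * max K 0 * s * ‖x‖ ^ 3 := by ring
      _ ≤ 8 * (C + max K 0) * s * ‖x‖ ^ 3 := by
          gcongr
          exact le_add_of_nonneg_left hC

/-! ## The stub -/

/-- **S2 — finite energy of a scar-sharing pair, with pure-scaling rates.**  From the apex bound on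
both fields, the gradient bounds and the far-field bound `‖V₁−V₂‖ ≤ K(−t)/‖x‖³` (`x ≠ 0`): the single
majorant `‖V₁−V₂‖ ≤ K'(−t)/(‖x‖+√−t)³` and, by the substitution `x = √(−t)·y`,
`‖(V₁−V₂)(t)‖_{L²} ≤ K'|t|^{1/4}`, `‖(V₁−V₂)(t)‖_{L^{6/5}} ≤ K'|t|^{3/4}`, `‖∇(V₁−V₂)(t)‖_{L²} ≤ K'|t|^{−1/4}`
for every `t < 0` (the profiles `(1+‖y‖)^{−6}`, `(1+‖y‖)^{−18/5}`, `(1+‖y‖)^{−4}` are integrable on `ℝ³`).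
[folklore] -/
theorem stub_twinNorms :
    ∀ (V₁ V₂ : ℝ → ℝ³ → ℝ³) (C L₁ L₂ K : ℝ), HasTypeIDecay C V₁ → HasTypeIDecay C V₂ →
      (∀ t < 0, ∀ x : ℝ³, ‖fderiv ℝ (V₁ t) x‖ ≤ L₁ / (‖x‖ + Real.sqrt (-t)) ^ 2) →
      (∀ t < 0, ∀ x : ℝ³, ‖fderiv ℝ (V₂ t) x‖ ≤ L₂ / (‖x‖ + Real.sqrt (-t)) ^ 2) →
      (∀ t < 0, ∀ x : ℝ³, x ≠ 0 → ‖V₁ t x - V₂ t x‖ ≤ K * (-t) / ‖x‖ ^ 3) →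
      ∃ K' : ℝ, 0 ≤ K' ∧ ∀ t < 0,
        (∀ x : ℝ³, ‖V₁ t x - V₂ t x‖ ≤ K' * (-t) / (‖x‖ + Real.sqrt (-t)) ^ 3) ∧
        eLpNorm (fun x => V₁ t x - V₂ t x) 2 volume ≤ ENNReal.ofReal (K' * (-t) ^ ((1 : ℝ) / 4)) ∧
        eLpNorm (fun x => V₁ t x - V₂ t x) ((6 : ℝ≥0∞) / 5) volume ≤
          ENNReal.ofReal (K' * (-t) ^ ((3 : ℝ) / 4)) ∧
        eLpNorm (fun x => fderiv ℝ (V₁ t) x - fderiv ℝ (V₂ t) x) 2 volume ≤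
          ENNReal.ofReal (K' * (-t) ^ (-(1 : ℝ) / 4)) := by
  intro V₁ V₂ C L₁ L₂ K hd₁ hd₂ hg₁ hg₂ hfar
  have hC : 0 ≤ C := nonneg_of_hasTypeIDecay hd₁
  -- the three profile constants (`L²` and `L^{6/5}` of `ρ⁻³`, `L²` of `ρ⁻²`)
  obtain ⟨A₁, hA₁, h₁⟩ := exists_eLpNorm_le_of_norm_le_radial (F := ℝ³) (p := 2) (q := 2) two_pos
    (by simp) (n := 3) (by norm_num) (γ := -(3 : ℝ) / 2) (by norm_num)
  obtain ⟨A₂, hA₂, h₂⟩ := exists_eLpNorm_le_of_norm_le_radial (F := ℝ³) (p := (6 : ℝ≥0∞) / 5)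
    (q := 6 / 5) (by norm_num) (by simp [ENNReal.toReal_div]) (n := 3) (by norm_num)
    (γ := -(1 : ℝ) / 2) (by norm_num)
  obtain ⟨A₃, hA₃, h₃⟩ := exists_eLpNorm_le_of_norm_le_radial (F := ℝ³ →L[ℝ] ℝ³) (p := 2) (q := 2)
    two_pos (by simp) (n := 2) (by norm_num) (γ := -(1 : ℝ) / 2) (by norm_num)
  set K₀ : ℝ := 8 * (C + max K 0) with hK₀
  have hK₀nn : 0 ≤ K₀ := by positivity
  set L : ℝ := |L₁| + |L₂| with hL
  have hLnn : 0 ≤ L := by positivity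
  obtain ⟨K', hK'nn, hK'₀, hK'₁, hK'₂, hK'₃⟩ :
      ∃ K' : ℝ, 0 ≤ K' ∧ K₀ ≤ K' ∧ A₁ * K₀ ≤ K' ∧ A₂ * K₀ ≤ K' ∧ A₃ * L ≤ K' := by
    have e₁ : 0 ≤ A₁ * K₀ := mul_nonneg hA₁ hK₀nn
    have e₂ : 0 ≤ A₂ * K₀ := mul_nonneg hA₂ hK₀nn
    have e₃ : 0 ≤ A₃ * L := mul_nonneg hA₃ hLnn
    exact ⟨K₀ + A₁ * K₀ + A₂ * K₀ + A₃ * L, by positivity, by linarith, by linarith, by linarith,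
      by linarith⟩
  refine ⟨K', hK'nn, fun t ht => ?_⟩
  have hmaj : ∀ x : ℝ³, ‖V₁ t x - V₂ t x‖ ≤ K₀ * (-t) / (‖x‖ + Real.sqrt (-t)) ^ 3 :=
    fun x => norm_sub_le_majorant hd₁ hd₂ hfar ht x
  have hmaj' : ∀ x : ℝ³,
      ‖fderiv ℝ (V₁ t) x - fderiv ℝ (V₂ t) x‖ ≤ L / (‖x‖ + Real.sqrt (-t)) ^ 2 := by
    intro x
    calc ‖fderiv ℝ (V₁ t) x - fderiv ℝ (V₂ t) x‖
        ≤ ‖fderiv ℝ (V₁ t) x‖ + ‖fderiv ℝ (V₂ t) x‖ := norm_sub_le _ _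
      _ ≤ L₁ / (‖x‖ + Real.sqrt (-t)) ^ 2 + L₂ / (‖x‖ + Real.sqrt (-t)) ^ 2 :=
          add_le_add (hg₁ t ht x) (hg₂ t ht x)
      _ ≤ |L₁| / (‖x‖ + Real.sqrt (-t)) ^ 2 + |L₂| / (‖x‖ + Real.sqrt (-t)) ^ 2 := by
          gcongr <;> exact le_abs_self _
      _ = L / (‖x‖ + Real.sqrt (-t)) ^ 2 := by rw [hL, add_div]
  have hs : 0 < -t := neg_pos.2 ht
  set s : ℝ := -t with hs_def
  have ha : 0 < Real.sqrt s := Real.sqrt_pos.2 hs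
  -- exponent bookkeeping: `√s ^ γ = s ^ (γ/2)`
  have hsqrt : ∀ γ : ℝ, Real.sqrt s ^ γ = s ^ (γ / 2) := fun γ => by
    rw [Real.sqrt_eq_rpow, ← Real.rpow_mul hs.le]
    congr 1
    ring
  refine ⟨fun x => (hmaj x).trans ?_, ?_, ?_, ?_⟩
  · -- (d): `K₀ ≤ K'`
    exact div_le_div_of_nonneg_right (mul_le_mul_of_nonneg_right hK'₀ hs.le) (by positivity)
  · -- (a): `L²`, exponent `1 - 3/4 = 1/4`
    refine (h₁ (Real.sqrt s) (K₀ * s) ha (by positivity) _ hmaj).trans (ENNReal.ofReal_le_ofReal ?_)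
    rw [hsqrt]
    have e : A₁ * (K₀ * s) * s ^ (-(3 : ℝ) / 2 / 2) = A₁ * K₀ * s ^ ((1 : ℝ) / 4) := by
      rw [show (1 : ℝ) / 4 = 1 + -(3 : ℝ) / 2 / 2 by norm_num, Real.rpow_add hs, Real.rpow_one]
      ring
    rw [e]
    exact mul_le_mul_of_nonneg_right hK'₁ (Real.rpow_nonneg hs.le _)
  · -- (b): `L^{6/5}`, exponent `1 - 1/4 = 3/4`
    refine (h₂ (Real.sqrt s) (K₀ * s) ha (by positivity) _ hmaj).trans (ENNReal.ofReal_le_ofReal ?_)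
    rw [hsqrt]
    have e : A₂ * (K₀ * s) * s ^ (-(1 : ℝ) / 2 / 2) = A₂ * K₀ * s ^ ((3 : ℝ) / 4) := by
      rw [show (3 : ℝ) / 4 = 1 + -(1 : ℝ) / 2 / 2 by norm_num, Real.rpow_add hs, Real.rpow_one]
      ring
    rw [e]
    exact mul_le_mul_of_nonneg_right hK'₂ (Real.rpow_nonneg hs.le _)
  · -- (c): gradient in `L²`, exponent `-1/4`
    refine (h₃ (Real.sqrt s) L ha hLnn _ hmaj').trans (ENNReal.ofReal_le_ofReal ?_)
    rw [hsqrt, show -(1 : ℝ) / 2 / 2 = -(1 : ℝ) / 4 by norm_num]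
    exact mul_le_mul_of_nonneg_right hK'₃ (Real.rpow_nonneg hs.le _)

end Summit.NavierStokesRegularity.NavierStokesRegularity.Theorems.RellichScarScarRigidity

end
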